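import Summits.CriticalPhenomena.PercolationContinuityZ3.Theorems.PercNearOneGluingNoHeavyQuantHullHigh
import Summits.CriticalPhenomena.PercolationContinuityZ3.Theorems.PercNearOneGluingNoHeavyQuantSiblingMixture
import HarnessLib

/-!
# QUANT lane R8, T-DEC: EVERY FOREST OF 2-CHAINS, OF EVERY WIDTH, IS SDEC AT EVERY TREE-OK FLOOR — no oracle, no certificates
# (the hull + high criterion applied to arm-1 g55's chords of the 2-chain)

builds on p205010 (kernel theorem, internal audit signed; external expert review pending)

Support file (`--supports stmt-CriticalPhenomena-4575`), QUANT lane seat prim-quant-census-1 (gen 29); memo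
`run/shared/lean/prim/quant/prim-quant-census-1/g29/HULLHIGH-G29.md` §2.  Theorems only, standard axioms, no sorries.  Over census-1 g29's
`…QuantHullHigh` (`IsHigh`, `HullHigh`, `HullHigh.mix`, `hullHigh_of_inBlobHull`, `hullHigh_of_isHigh`, `sdec_flaw_of_hullHigh`) and arm-1 g55's
`…QuantSiblingMixture` (`twoChain_mix_lo`, `twoChain_mix_hi`, `twoChain_mix_weights`: the two chords of a 2-chain's mean fibre).

THE RESULT.  The gated 2-chain `gate_q(δ₁ ∗ gate_p δ₁) = (1−q, q(1−p), qp)`, mean `m = q(1+p)`, is by arm-1 g55's chords a same-mean mixture of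
the gated double blob `gate_{m/2} δ₂` and either the gated relay `gate_m δ₁` (`m ≤ 1`) or the near-sure extreme `{1: 2−m, 2: m−1}` (`m ≥ 1`).  The
first two are heavy blob laws at every floor `x ≤ m/2` (`inBlobHull_double`, `inBlobHull_relay`); the third — "the only extreme outside the slice
lemmas" (ARCH-G55 §0 (6)) — is HIGH (`isHigh_lawC`: its charged atoms `1, 2` are `≥ m/2`).  So **every gated 2-chain is hull+high decomposable at
every floor `x ≤ q(1+p)/2`** (`hullHigh_twoChain`), and by `sdec_flaw_of_hullHigh`:
* **`sdec_twoChainForest`**: for `0 < x < 1` and ANY list of 2-chains `R[qᵢ](R[pᵢ])` (`0 < qᵢ < 1`, `0 ≤ pᵢ ≤ 1`) with `2x ≤ qᵢ(1+pᵢ)` for every `i`,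
  the forest law is `SDEC x (ftop L) (flaw L)`;
* **`sdec_twoChainForest_treeOK`**: the `Sib.TreeOK` form — every nonempty tree-OK list of 2-chains, EVERY WIDTH, every tree-OK floor, no oracle.
Earlier rows of the same family: width 3 symmetric (arm-1 g54 `sdec_tc3`), width 3 general (arm-1 g55 `sdec_triple_twoChain`, eleven Handelman
certificates; it also covers the forest-top-affordable floors `6x ≤ Σmᵢ` above `min mᵢ/2`, which this file does not), every width in the symmetric
light band (census-1 g28 `sdec_symForest_twoChain_light_treeOK`), every width symmetric with `q ≤ 1/2` given the oracle (arm-1 g53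
`sdec_symForest_trueFloor`).  Here: every width, every parameter set, at once, by a structural (certificate-free) argument.  On the node's binder
the 2-chain forests were the first test family of `SiblingStep` (README V393); they are now closed unconditionally at every width.

HONEST STATUS.  Family theorem; `SiblingStep` ⟺ `GateStepN`, `UPartStep`, `LightResidDECOracle`, `FarTreeRow` OPEN; RATE class (log\*) / honest
sentence of `run/shared/lean/prim/quant/README.md` unchanged.  [this work].  Nothing here is cited as a published result.  The gluing rows served
[cite: KozmaNitzan2024, Conjecture 3 (p. 15)]; product measure [cite: Grimmett1999, §1.3 p. 10].
-/

noncomputable section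

open scoped BigOperators

namespace Summit.CriticalPhenomena.PercolationContinuityZ3.Theorems
namespace Quant
namespace LawDec

open Finset

/-- the point mass `δ_K` -/
local notation3 "δ[" K "]" => (fun k : ℕ => if k = (K : ℕ) then (1 : ℝ) else 0)

/-- the 2-chain sub-forest law `ρ_p = δ₁ ∗ gate_p δ₁` -/
local notation3 "ρ₂[" p "]" => lconv 1 1 (fun k : ℕ => if k = (1 : ℕ) then (1 : ℝ) else 0)
  (gate (fun k : ℕ => if k = (1 : ℕ) then (1 : ℝ) else 0) p)

/-- the 2-chain sibling `t = gate_q(δ₁ ∗ gate_p δ₁)` = `R[q](R[p])` with recorded sub-floor `x₁` and gate count `1` -/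
local notation3 "TC[" q ", " p ", " x₁ "]" => (⟨q, x₁, 1, 2, ρ₂[p]⟩ : Sib)

/-! ### The three extreme laws of a 2-chain's mean fibre are hull or high -/

/-- a gated point mass is the law of one heavy blob: `gate δ_K g = blobLaw [(K, g)]` (`K ≠ 0`). [this work] -/
theorem gate_point_eq_blobLaw (K : ℕ) (hK : K ≠ 0) (g : ℝ) : gate δ[K] g = blobLaw [(K, g)] := by
  funext h
  rw [blobLaw_single_apply, gate_apply]
  have hK0 : (0 : ℕ) ≠ K := Ne.symm hK
  by_cases h0 : h = 0
  · subst h0; simp [hK0]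
  · by_cases hK' : h = K
    · subst hK'; simp [hK]
    · simp [h0, hK']

/-- **the gated double blob `gate_{m/2} δ₂` lies in the blob hull** at every floor `x ≤ m/2` (`m ≤ 2`). [this work] -/
theorem inBlobHull_double {x m : ℝ} (hx : 2 * x ≤ m) (hm : m ≤ 2) : InBlobHull x m 2 (gate δ[2] (m / 2)) := by
  rw [gate_point_eq_blobLaw 2 two_ne_zero]
  have e : blobMean [(2, m / 2)] = m := by simp [blobMean]; ring
  have key := inBlobHull_blobLaw x [(2, m / 2)] (fun p hp => by
    rw [List.mem_singleton] at hp; subst hp; exact ⟨by dsimp only; linarith, by dsimp only; linarith⟩) (M := 2) (by simp [blobTop])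
  rwa [e] at key

/-- **the gated relay `gate_m δ₁` lies in the blob hull** (top `2`) at every floor `x ≤ m` (`m ≤ 1`). [this work] -/
theorem inBlobHull_relay {x m : ℝ} (hx : x ≤ m) (hm : m ≤ 1) : InBlobHull x m 2 (gate δ[1] m) := by
  rw [gate_point_eq_blobLaw 1 one_ne_zero]
  have e : blobMean [(1, m)] = m := by simp [blobMean]
  have key := inBlobHull_blobLaw x [(1, m)] (fun p hp => by
    rw [List.mem_singleton] at hp; subst hp; exact ⟨hx, hm⟩) (M := 2) (by simp [blobTop])
  rwa [e] at key

/-- **THE NEAR-SURE EXTREME IS HIGH**: `{1: 2−m, 2: m−1}` (a sure relay with an under-relay of gate `m − 1`, arm-1 g55's `lawC`) is a high law of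
mean `m` at every floor with `2x ≤ m`, for `1 ≤ m ≤ 2` — its charged atoms `1, 2` are `≥ m/2`. [this work] -/
theorem isHigh_lawC {x m : ℝ} (hm1 : 1 ≤ m) (hm2 : m ≤ 2) (hx : 2 * x ≤ m) : IsHigh x m 2 (ρ₂[m - 1]) := by
  have app : ∀ h : ℕ, (ρ₂[m - 1]) h = (if h = 1 then 2 - m else 0) + (if h = 2 then m - 1 else 0) := fun h => by
    rw [tc_rho_apply]; split_ifs <;> ring
  refine ⟨fun h => ?_, fun h hh => ?_, ?_, ?_, fun h hpos => ?_, by push_cast; linarith⟩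
  · rw [app]; split_ifs <;> linarith
  · rw [app, if_neg (by omega), if_neg (by omega), add_zero]
  · rw [Finset.sum_range_succ, Finset.sum_range_succ, Finset.sum_range_succ, Finset.sum_range_zero, app 0, app 1, app 2]
    norm_num
  · rw [Finset.sum_range_succ, Finset.sum_range_succ, Finset.sum_range_succ, Finset.sum_range_zero, app 0, app 1, app 2]
    norm_num; ring
  · rw [app] at hpos
    by_cases h1 : h = 1
    · subst h1; push_cast; linarith
    · by_cases h2 : h = 2
      · subst h2; push_cast; linarith
      · rw [if_neg h1, if_neg h2, add_zero] at hpos; exact absurd hpos (lt_irrefl 0)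

/-- **EVERY GATED 2-CHAIN IS HULL + HIGH DECOMPOSABLE AT EVERY FLOOR `x ≤ q(1+p)/2`**: by arm-1 g55's chords (`twoChain_mix_lo/hi`),
`gate_q(δ₁ ∗ gate_p δ₁)` is a same-mean mixture of the gated double blob `gate_{m/2}δ₂` (hull) and either the gated relay `gate_m δ₁` (hull,
`m ≤ 1`) or the near-sure extreme `{1: 2−m, 2: m−1}` (HIGH, `m ≥ 1`), `m = q(1+p)`. [this work] -/
theorem hullHigh_twoChain {q p x : ℝ} (hq0 : 0 < q) (hq1 : q < 1) (hp0 : 0 ≤ p) (hp1 : p ≤ 1) (hx : 2 * x ≤ q * (1 + p)) :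
    HullHigh x (q * (1 + p)) 2 (gate (ρ₂[p]) q) := by
  obtain ⟨w0, w1, v0, v1⟩ := twoChain_mix_weights hq0 hq1 hp0 hp1
  have hm2 : q * (1 + p) ≤ 2 := by nlinarith
  have hm0 : 0 < q * (1 + p) := by positivity
  have hD : HullHigh x (q * (1 + p)) 2 (gate δ[2] (q * (1 + p) / 2)) := hullHigh_of_inBlobHull (inBlobHull_double hx hm2)
  by_cases hm : q * (1 + p) ≤ 1
  · have e : gate (ρ₂[p]) q = fun h => (2 * q * p / (q * (1 + p))) * gate δ[2] (q * (1 + p) / 2) h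
        + (1 - 2 * q * p / (q * (1 + p))) * gate δ[1] (q * (1 + p)) h := funext (twoChain_mix_lo hq0 hp0)
    rw [e]
    exact hD.mix (hullHigh_of_inBlobHull (inBlobHull_relay (by linarith) hm)) w0 w1
  · have e : gate (ρ₂[p]) q = fun h => (2 * (1 - q) / (2 - q * (1 + p))) * gate δ[2] (q * (1 + p) / 2) h
        + (1 - 2 * (1 - q) / (2 - q * (1 + p))) * (ρ₂[q * (1 + p) - 1]) h := funext (twoChain_mix_hi hq1 hp0 hp1)
    rw [e]
    exact hD.mix (hullHigh_of_isHigh (isHigh_lawC (by linarith) hm2 hx)) v0 v1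

/-! ### Every forest of 2-chains, every width -/

/-- the mean of the 2-chain sub-forest law `δ₁ ∗ gate_p δ₁` is `1 + p`. [this work] -/
theorem tc_sib_mean (q p x₁ : ℝ) : Sib.mean TC[q, p, x₁] = 1 + p := by
  simp [Sib.mean, Finset.sum_range_succ, tc_rho_apply]; ring

/-- **EVERY FOREST OF 2-CHAINS IS SDEC — EVERY WIDTH, NO ORACLE.**  For a floor `0 < x < 1` and any list of parameter triples
`(qᵢ, pᵢ, x₁ᵢ)` with `0 < qᵢ < 1`, `0 ≤ pᵢ ≤ 1` and `2x ≤ qᵢ(1 + pᵢ)` (the floor is below half of every sibling's mean; every tree-OK floor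
qualifies), the forest law of the 2-chain siblings `R[qᵢ](R[pᵢ])` is `SDEC x (ftop L) (flaw L)`.  Width-free and certificate-free: every sibling is
hull+high decomposable (`hullHigh_twoChain`), `sdec_flaw_of_hullHigh`. [this work] -/
theorem sdec_twoChainForest {x : ℝ} (hx0 : 0 < x) (hx1 : x < 1) (P : List (ℝ × ℝ × ℝ))
    (hP : ∀ t ∈ P, 0 < t.1 ∧ t.1 < 1 ∧ 0 ≤ t.2.1 ∧ t.2.1 ≤ 1 ∧ 2 * x ≤ t.1 * (1 + t.2.1)) :
    SDEC x (ftop (P.map fun t => TC[t.1, t.2.1, t.2.2])) (flaw (P.map fun t => TC[t.1, t.2.1, t.2.2])) := by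
  refine sdec_flaw_of_hullHigh hx0 hx1 _ fun s hs => ?_
  rw [List.mem_map] at hs
  obtain ⟨t, ht, rfl⟩ := hs
  obtain ⟨hq0, hq1, hp0, hp1, hxt⟩ := hP t ht
  show HullHigh x (t.1 * Sib.mean TC[t.1, t.2.1, t.2.2]) 2 (gate (ρ₂[t.2.1]) t.1)
  rw [tc_sib_mean]
  exact hullHigh_twoChain hq0 hq1 hp0 hp1 hxt

/-- **THE TREE-OK FORM**: for a floor `0 < x` and a nonempty list of 2-chain siblings `R[qᵢ](R[pᵢ])` each tree-OK at `x` (any admissible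
sub-floors `x₁ᵢ`), `SDEC x (ftop L) (flaw L)` — every width, no oracle, no further hypothesis.  (Width 3: arm-1 g55's `sdec_triple_twoChain`;
the symmetric light band: census-1 g28's `sdec_symForest_twoChain_light_treeOK`; here EVERY width and EVERY parameter set at once.) [this work] -/
theorem sdec_twoChainForest_treeOK {x : ℝ} (hx0 : 0 < x) (P : List (ℝ × ℝ × ℝ)) (hne : P ≠ [])
    (hP : ∀ t ∈ P, Sib.TreeOK x TC[t.1, t.2.1, t.2.2]) :
    SDEC x (ftop (P.map fun t => TC[t.1, t.2.1, t.2.2])) (flaw (P.map fun t => TC[t.1, t.2.1, t.2.2])) := by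
  -- the tree-OK data of one sibling: `0 < q < 1`, `0 ≤ p ≤ 1`, `2x ≤ q(1+p)`, and `x < 1`
  have data : ∀ t ∈ P, (0 < t.1 ∧ t.1 < 1 ∧ 0 ≤ t.2.1 ∧ t.2.1 ≤ 1 ∧ 2 * x ≤ t.1 * (1 + t.2.1)) ∧ x < 1 := by
    intro t ht
    obtain ⟨hq0, hq1, hxq, hT, _⟩ := hP t ht
    obtain ⟨hx₁0, hx₁1, ρ0, _, _, hta⟩ := hT.lawFacts
    have h1 : 0 ≤ (ρ₂[t.2.1]) 1 := ρ0 1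
    have h2 : 0 ≤ (ρ₂[t.2.1]) 2 := ρ0 2
    rw [tc_rho_apply] at h1 h2
    norm_num at h1 h2
    have hta' : t.2.2 * 2 ≤ 1 + t.2.1 := by
      have hm : ∑ k ∈ Finset.range (2 + 1), (k : ℝ) * (ρ₂[t.2.1]) k = 1 + t.2.1 := by
        rw [← tc_sib_mean t.1 t.2.1 t.2.2]; rfl
      change t.2.2 * ((2 : ℕ) : ℝ) ≤ ∑ k ∈ Finset.range (2 + 1), (k : ℝ) * (ρ₂[t.2.1]) k at hta
      rw [hm] at hta
      exact_mod_cast hta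
    change x ≤ t.1 * t.2.2 at hxq
    refine ⟨⟨hq0, hq1, h2, by linarith, by nlinarith⟩, ?_⟩
    calc x ≤ t.1 * t.2.2 := hxq
      _ < 1 * 1 := mul_lt_mul'' hq1 hx₁1 hq0.le hx₁0.le
      _ = 1 := one_mul 1
  obtain ⟨t₀, ht₀⟩ := List.exists_mem_of_ne_nil P hne
  exact sdec_twoChainForest hx0 (data t₀ ht₀).2 P fun t ht => (data t ht).1

end LawDec
end Quant
end Summit.CriticalPhenomena.PercolationContinuityZ3.Theorems
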